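import Literature.NumberTheory.EllipticCurves.LocalEulerCharacteristicTorsion
import Literature.NumberTheory.EllipticCurves.LocalKummerMap
import HarnessLib

/-!
# The relaxation index of the classical local condition at `v`: `[H¹(K_v, E[n]) : 𝓛_v] = #E(K_v)[n] · #(𝓞_v/n)`
# (cell `b2b-bsdres`, team n1011, sub-target T-a3 "Kim 2026 Thm 1.8 (6) at p = 3", step S1.H)

HONEST FRAMING (cell `b2b-bsdres`, run/shared/lean/b2b/bsd-rank1-residual/, verbatim in every
file): the goal of the cell is to DELETE the COMBINATION-SHAPED residual classes of the
Birch–Swinnerton-Dyer formula for ALL analytic-rank `≤ 1` elliptic curves over `ℚ` — "full BSD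
formula for every rank `≤ 1` curve in class `C`" assembled STRICTLY from published theorems — so
that the rank-`≤ 1` remainder becomes exactly the CONSTRUCTION-SHAPED classes, which are TYPED
(missing-input `Prop`s), NOT attempted. This is not "finishing BSD". Team n1011 (N10/N11, the
additive block `X4 ∧ p = 3`): research route; no claim beyond the stated classes; the label X4 and
the mark of RESIDUAL-MAP §I N11 are UNCHANGED by this file; nothing is booked. Theorems only: no
definition, no named fact minted (the one arithmetic input, Tate's local Euler–Poincaré
characteristic, is the tree's named fact `localEulerPoincareCharacteristic K_v`, carried as an
explicit hypothesis exactly as in `LocalEulerCharacteristicTorsion.lean`).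

## What this file proves and why

Skeleton `HOME/cells/n1011/skel/T-a3.md`, step S1 ("the Mazur–Rubin package at `p = 3`"): at
`p = 3` hypothesis (H.4) of Mazur–Rubin fails for `T₃E` and is replaced by Sakamoto,
Doc. Math. 27 (2022), Appendix §5, whose Thm 5.16 is stated for a Selmer structure `𝓕 = 𝓖^r`
obtained from a residually self-dual structure `𝓖` by relaxing the local condition at ONE prime `r`
where (bullet 1) `dim_𝔽 H¹(ℚ_r, T̄)/H¹_𝓖(ℚ_r, T̄) = 1`. For an elliptic curve, `𝓖 = 𝓕_cl`
(Kummer conditions) and `r = p`, this says the local Kummer condition `𝓛_p ⊂ H¹(ℚ_p, E[p])` has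
index exactly `p`. This file computes that index in general, from two tree theorems:

* `natCard_galoisCohomology_one_torsion_adicCompletion_eq_sq`
  (`#H¹(K_v, E[n]) = (#E(K_v)[n] · #(𝓞_v/n))²`, Milne *ADT* I Thm 2.8 for `M = E[n]`), and
* `natCard_kummerLocalConditionAt_adicCompletion` (`#𝓛_v = #E(K_v)[n] · #(𝓞_v/n)`, Milne I
  Lemma 3.3 with the local Kummer sequence),

namely (`index_kummerLocalConditionAt_adicCompletion`)

  **`[H¹(K_v, E[n]) : 𝓛_v] = #E(K_v)[n] · #(𝓞_v/n)`**   (`n` a prime power, `v` finite),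

so that (`index_kummerLocalConditionAt_eq_iff_torsionFree`) the index takes its minimal value
`#(𝓞_v/n)` — for `K = ℚ`, `v = p`, `n = p`: the value `p`, i.e. Sakamoto's bullet 1 — **if and
only if `E(K_v)[n] = 0`**. This is the kernel form of the statement in T-a3 §2 that the price of
the `p = 3` substitution is the binder (L) `E(ℚ₃)[3] = 0` (Kim's `t = 0`; at an additive `3` the
Kosters–Pannekoek non-exceptional case up to the component group).

References: Milne, *Arithmetic Duality Theorems* (2006) I Thm 2.8, Lemma 3.3, Cor 3.4
[MilneADT2006]; R. Sakamoto, Doc. Math. 27 (2022) 1891–1922, Thm 5.16 and Rem 5.6/5.17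
[Sakamoto2022pSelmer]; C.-H. Kim, Amer. J. Math. 148 (2026), §1.2.5, Prop 3.2 [Kim2022StructureSelmer].
-/

noncomputable section

open scoped Classical

universe u

namespace Summit.BirchSwinnertonDyer.Rank1Residual.Additive

open WeierstrassCurve Field Function NumberField IsDedekindDomain
open Literature.NumberTheory.EllipticCurves Literature.NumberTheory.GaloisRepresentations

variable {K : Type u} [Field K] [NumberField K] (W : WeierstrassCurve K) [W.IsElliptic]
variable (v : HeightOneSpectrum (𝓞 K))

/-- **`#H¹(K_v, E[n]) = #𝓛_v · (#E(K_v)[n] · #(𝓞_v/n))`** for a prime power `n` at a finite place `v`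
of a number field: Milne I Thm 2.8 for `E[n]` (tree `natCard_galoisCohomology_one_torsion_adicCompletion_eq_sq`)
divided by Milne I Lemma 3.3 (tree `natCard_kummerLocalConditionAt_adicCompletion`).
[cite: MilneADT2006, Ch. I, Thm. 2.8 and Lemma 3.3] -/
theorem natCard_galoisCohomology_one_torsion_eq_natCard_kummer_mul (n : ℕ) [NeZero n]
    (hn : IsPrimePow n) (hEP : localEulerPoincareCharacteristic (v.adicCompletion K)) :
    Nat.card (galoisCohomology
        (GaloisRep.restrictField (v.adicCompletion K) (W.torsionGaloisModule n)) 1) =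
      Nat.card (W.kummerLocalConditionAt (n : ℤ) (v.adicCompletion K)) *
        (Nat.card (nsmulAddMonoidHom n :
            (W.baseChange (v.adicCompletion K)).toAffine.Point →+ _).ker *
          Nat.card (v.adicCompletionIntegers K ⧸
            Ideal.span {(n : v.adicCompletionIntegers K)})) := by
  rw [natCard_galoisCohomology_one_torsion_adicCompletion_eq_sq W v n hn hEP,
    W.natCard_kummerLocalConditionAt_adicCompletion v (NeZero.ne n)]
  ring

/-- **The relaxation index `[H¹(K_v, E[n]) : 𝓛_v] = #E(K_v)[n] · #(𝓞_v/n)`** (prime power `n`,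
finite place `v`): the index of the local Kummer condition in the full local cohomology — the
amount by which Mazur–Rubin's canonical structure `𝓕_can` relaxes the classical one at `v ∣ n`
(Sakamoto 2022, Thm 5.16, bullet 1, measures exactly this). Lagrange (`card = card · index`) with the
previous count; `H¹(K_v, E[n])` is finite by Milne I Thm 2.8.
[cite: MilneADT2006, Ch. I, Thm. 2.8, Lemma 3.3, Cor. 3.4] [cite: Sakamoto2022pSelmer, Thm. 5.16 and Remark 5.17] -/
theorem index_kummerLocalConditionAt_adicCompletion (n : ℕ) [NeZero n] (hn : IsPrimePow n)
    (hEP : localEulerPoincareCharacteristic (v.adicCompletion K)) :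
    (W.kummerLocalConditionAt (n : ℤ) (v.adicCompletion K)).index =
      Nat.card (nsmulAddMonoidHom n :
          (W.baseChange (v.adicCompletion K)).toAffine.Point →+ _).ker *
        Nat.card (v.adicCompletionIntegers K ⧸
          Ideal.span {(n : v.adicCompletionIntegers K)}) := by
  have hL : Nat.card (W.kummerLocalConditionAt (n : ℤ) (v.adicCompletion K)) ≠ 0 := by
    rw [W.natCard_kummerLocalConditionAt_adicCompletion v (NeZero.ne n)]
    haveI := W.finite_ker_nsmul_adicCompletion v (NeZero.ne n)
    exact mul_ne_zero Nat.card_pos.ne' (LocalPoints.card_quotient_span_natCast_ne_zero v (NeZero.ne n))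
  have hmul := (W.kummerLocalConditionAt (n : ℤ) (v.adicCompletion K)).card_mul_index
  rw [natCard_galoisCohomology_one_torsion_eq_natCard_kummer_mul W v n hn hEP] at hmul
  exact (mul_right_injective₀ hL hmul.symm).symm

/-- **The relaxation at `v` is the minimal one, `[H¹(K_v, E[n]) : 𝓛_v] = #(𝓞_v/n)`, iff `E(K_v)[n] = 0`.**
For `K = ℚ`, `v = p`, `n = p` this is Sakamoto's hypothesis "`dim_𝔽 H¹(ℚ_p, E[p])/H¹_{𝓕_cl}(ℚ_p, E[p]) = 1`"
(Doc. Math. 27 (2022) Thm 5.16, bullet 1, with Rem 5.6/5.17: `𝓖 = 𝓕_cl`, `r = p`, `𝓖^r = 𝓕_can`),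
and the right-hand side is Kim's `t = 0` (`p^t = #E(ℚ_p)[p^∞]`; Amer. J. Math. 148 (2026) Prop 3.2):
the binder (L) of skeleton T-a3. Bookkeeping from `index_kummerLocalConditionAt_adicCompletion`.
[cite: Sakamoto2022pSelmer, Thm. 5.16 and Remarks 5.6, 5.17] [cite: Kim2022StructureSelmer, Prop. 3.2 (PDF p. 15)]
[cite: MilneADT2006, Ch. I, Lemma 3.3] -/
theorem index_kummerLocalConditionAt_eq_iff_torsionFree (n : ℕ) [NeZero n] (hn : IsPrimePow n)
    (hEP : localEulerPoincareCharacteristic (v.adicCompletion K)) :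
    (W.kummerLocalConditionAt (n : ℤ) (v.adicCompletion K)).index =
        Nat.card (v.adicCompletionIntegers K ⧸ Ideal.span {(n : v.adicCompletionIntegers K)}) ↔
      ∀ P : (W.baseChange (v.adicCompletion K)).toAffine.Point, n • P = 0 → P = 0 := by
  haveI := W.finite_ker_nsmul_adicCompletion v (NeZero.ne n)
  have hq : Nat.card (v.adicCompletionIntegers K ⧸ Ideal.span {(n : v.adicCompletionIntegers K)}) ≠ 0 :=
    LocalPoints.card_quotient_span_natCast_ne_zero v (NeZero.ne n)
  rw [index_kummerLocalConditionAt_adicCompletion W v n hn hEP]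
  constructor
  · intro h
    have h1 : Nat.card (nsmulAddMonoidHom n :
        (W.baseChange (v.adicCompletion K)).toAffine.Point →+ _).ker = 1 :=
      Nat.eq_of_mul_eq_mul_right (Nat.pos_of_ne_zero hq) (h.trans (one_mul _).symm)
    intro P hP
    have hmem : P ∈ (nsmulAddMonoidHom n :
        (W.baseChange (v.adicCompletion K)).toAffine.Point →+ _).ker := hP
    haveI : Subsingleton (nsmulAddMonoidHom n :
        (W.baseChange (v.adicCompletion K)).toAffine.Point →+ _).ker :=
      (Nat.card_eq_one_iff_unique.mp h1).1
    have : (⟨P, hmem⟩ : (nsmulAddMonoidHom n :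
        (W.baseChange (v.adicCompletion K)).toAffine.Point →+ _).ker) = ⟨0, by simp⟩ :=
      Subsingleton.elim _ _
    exact congrArg Subtype.val this
  · intro h
    have h1 : Nat.card (nsmulAddMonoidHom n :
        (W.baseChange (v.adicCompletion K)).toAffine.Point →+ _).ker = 1 := by
      rw [Nat.card_eq_one_iff_unique]
      refine ⟨⟨fun a b => Subtype.ext ?_⟩, ⟨⟨0, by simp⟩⟩⟩
      have ha := h a.1 a.2
      have hb := h b.1 b.2
      rw [ha, hb]
    rw [h1, one_mul]

end Summit.BirchSwinnertonDyer.Rank1Residual.Additive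

end
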